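import Mathlib
import Summits.Ventures.HodgeRepro.Tier4.Common.AutForms

/-!
# Tier4/Common/CornerForms — the corner forms `alb_i^* ω_{i,σ}` on the target's own objects: invariant and non-zero

Blind re-derivation cell `pub-hodge-repro`, Tier 4 (README §9–§10), seat t4-typer-1 (gen 0).  Target tree path
`lean/Summits/Ventures/HodgeRepro/Tier4/Common/CornerForms.lean`.  Imports `Tier4/Common/AutForms.lean` (typer-1:
`grad`, `pullField`, `IsAutForm1`, `autForms1`, the ball and the action of `Γ`).

WHAT IS DEFINED.  `d.coord i σ hσ` = the `σ`-coordinate of the Albanese lift `a_i` (`σ ∈ T_i`), and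
`d.cornerField i σ hσ` = its gradient restricted to the ball (zero outside) — the pull-back to the ball of the
eigen-`1`-form `ω_{i,σ}` of the corner `A_{T_i}` along `alb_i` (the objects `ω_{i,s}`, `ω_{i,s̄}` of (P)).

WHAT IS PROVED.  `exists_const_sub`: for `γ ∈ Γ`, `a_i ∘ act γ − a_i` is CONSTANT on the ball (a continuous map of
the convex ball into the discrete lattice `Λ_i`, `IsPreconnected.constant_of_mapsTo`); hence
`cornerField_isAutForm1`: the corner field is an invariant `1`-form for every level `Γ′ ⊆ Γ` (chain rule +
`fderiv_add_const`); `cornerField_ne_zero`: it is non-zero (a vanishing gradient makes the coordinate constant on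
the convex ball, `Convex.is_const_of_fderivWithin_eq_zero`, contradicting the span clause of `IsAlbaneseLift`).

Nothing here says anything about the status of the Hodge conjecture for CM abelian varieties, which is NOT proved
(HC_CM is NOT proved by anyone in this repository).
-/

set_option autoImplicit false

noncomputable section

open Matrix MeasureTheory NumberField
open scoped ComplexConjugate ComplexOrder

namespace Summit.Ventures.HodgeRepro.Tier4

namespace TargetData

variable {F E : Type} [Field F] [NumberField F] [IsGalois ℚ F] [IsCMField F]
  [Field E] [NumberField E] [IsGalois ℚ E] [IsCMField E] (d : TargetData F E)

/-! ## The corner forms -/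

/-- The `σ`-coordinate of the `i`-th Albanese lift, `σ ∈ T_i`. -/
def coord (i : Fin 4) (σ : F →+* ℂ) (hσ : σ ∈ d.T i) : (Fin 2 → ℂ) → ℂ := comp (d.T i) σ hσ (d.a i)

/-- The coordinate is holomorphic on the ball. -/
theorem differentiableOn_coord (i : Fin 4) (σ : F →+* ℂ) (hσ : σ ∈ d.T i) :
    DifferentiableOn ℂ (d.coord i σ hσ) ball := fun z hz =>
  (differentiableWithinAt_pi.1 ((d.ha i).1 z hz)) ⟨σ, hσ⟩

/-- The coordinate is differentiable at every point of the ball. -/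
theorem differentiableAt_coord (i : Fin 4) (σ : F →+* ℂ) (hσ : σ ∈ d.T i) {z : Fin 2 → ℂ} (hz : z ∈ ball) :
    DifferentiableAt ℂ (d.coord i σ hσ) z :=
  (d.differentiableOn_coord i σ hσ).differentiableAt (isOpen_ball.mem_nhds hz)

/-- **The corner form** `alb_i^* ω_{i,σ}`: the gradient of the `σ`-coordinate of the Albanese lift, restricted to
the ball (zero outside it). -/
def cornerField (i : Fin 4) (σ : F →+* ℂ) (hσ : σ ∈ d.T i) : (Fin 2 → ℂ) → (Fin 2 → ℂ) :=
  ball.indicator (grad (d.coord i σ hσ))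

/-- On the ball the corner field is the gradient of the coordinate. -/
theorem cornerField_of_mem (i : Fin 4) (σ : F →+* ℂ) (hσ : σ ∈ d.T i) {z : Fin 2 → ℂ} (hz : z ∈ ball) :
    d.cornerField i σ hσ z = grad (d.coord i σ hσ) z :=
  Set.indicator_of_mem hz _

/-- Outside the ball the corner field vanishes. -/
theorem cornerField_of_not_mem (i : Fin 4) (σ : F →+* ℂ) (hσ : σ ∈ d.T i) {z : Fin 2 → ℂ} (hz : z ∉ ball) :
    d.cornerField i σ hσ z = 0 :=
  Set.indicator_of_notMem hz _

/-- **The Albanese lift is equivariant up to a CONSTANT lattice vector**: for `γ ∈ Γ`, `a_i ∘ act γ − a_i` is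
constant on the ball (a continuous map of the convex ball into the discrete lattice `Λ_i`). -/
theorem exists_const_sub (i : Fin 4) {γ : Matrix (Fin 3) (Fin 3) E} (hγ : γ ∈ d.Γ) :
    ∃ lam : ↥(d.T i) → ℂ, ∀ z ∈ ball, d.a i (d.act γ z) - d.a i z = lam := by
  obtain ⟨z₀, hz₀⟩ : ∃ z₀ : Fin 2 → ℂ, z₀ ∈ ball := ⟨0, by simp [ball, nsq]⟩
  refine ⟨d.a i (d.act γ z₀) - d.a i z₀, fun z hz => ?_⟩
  have hdisc : IsDiscrete ((d.Λ i : Set (↥(d.T i) → ℂ))) := by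
    rw [SetLike.isDiscrete_iff_discreteTopology]
    exact d.discrete i
  have hcont : ContinuousOn (fun w => d.a i (d.act γ w) - d.a i w) ball := by
    have h1 : ContinuousOn (d.a i) ball := (d.ha i).1.continuousOn
    have h2 : ContinuousOn (fun w => d.a i (d.act γ w)) ball :=
      h1.comp (d.differentiableOn_act hγ).continuousOn fun w hw => d.act_mem_ball hγ hw
    exact h2.sub h1
  have hmaps : Set.MapsTo (fun w => d.a i (d.act γ w) - d.a i w) ball (d.Λ i : Set (↥(d.T i) → ℂ)) :=
    fun w hw => (d.ha i).2.1 γ hγ w hw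
  exact isPreconnected_ball.constant_of_mapsTo hdisc hcont hmaps hz hz₀

/-- The coordinate transforms by an additive constant under `Γ`. -/
theorem exists_const_coord_sub (i : Fin 4) (σ : F →+* ℂ) (hσ : σ ∈ d.T i) {γ : Matrix (Fin 3) (Fin 3) E}
    (hγ : γ ∈ d.Γ) : ∃ c : ℂ, ∀ z ∈ ball, d.coord i σ hσ (d.act γ z) = d.coord i σ hσ z + c := by
  obtain ⟨lam, hlam⟩ := d.exists_const_sub i hγ
  refine ⟨lam ⟨σ, hσ⟩, fun z hz => ?_⟩
  have := congrFun (hlam z hz) ⟨σ, hσ⟩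
  simp only [Pi.sub_apply] at this
  unfold coord comp
  linear_combination this

/-- **The corner form is a `1`-form on `X_{Γ′}`** for every congruence level `Γ′ ⊆ Γ`: zero outside the ball and
invariant under the pull-back along the action of `Γ′`. -/
theorem cornerField_isAutForm1 (i : Fin 4) (σ : F →+* ℂ) (hσ : σ ∈ d.T i)
    {Γ' : Set (Matrix (Fin 3) (Fin 3) E)} (hΓ' : Γ' ⊆ d.Γ) : d.IsAutForm1 Γ' (d.cornerField i σ hσ) := by
  refine ⟨fun z hz => d.cornerField_of_not_mem i σ hσ hz, fun γ hγ z hz => ?_⟩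
  have hγΓ : γ ∈ d.Γ := hΓ' hγ
  have hzγ : d.act γ z ∈ ball := d.act_mem_ball hγΓ hz
  rw [d.cornerField_of_mem i σ hσ hz]
  -- the pull-back of the field at `z` only sees the field at `act γ z ∈ ball`
  have hpull : pullField (d.act γ) (d.cornerField i σ hσ) z = pullField (d.act γ) (grad (d.coord i σ hσ)) z := by
    simp only [pullField]
    rw [d.cornerField_of_mem i σ hσ hzγ]
  rw [hpull, pullField_grad (d.differentiableAt_coord i σ hσ hzγ) (d.differentiableAt_act hγΓ hz)]
  -- `coord ∘ act γ = coord + c` near `z`, so the gradients agree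
  obtain ⟨c, hc⟩ := d.exists_const_coord_sub i σ hσ hγΓ
  have heq : (d.coord i σ hσ ∘ d.act γ) =ᶠ[nhds z] fun w => d.coord i σ hσ w + c := by
    filter_upwards [isOpen_ball.mem_nhds hz] with w hw
    exact hc w hw
  funext k
  simp only [grad, pd]
  rw [heq.fderiv_eq, fderiv_add_const]

/-- The corner field lies in `autForms1 Γ′` for every level `Γ′ ⊆ Γ`. -/
theorem cornerField_mem_autForms1 (i : Fin 4) (σ : F →+* ℂ) (hσ : σ ∈ d.T i)
    {Γ' : Set (Matrix (Fin 3) (Fin 3) E)} (hΓ' : Γ' ⊆ d.Γ) : d.cornerField i σ hσ ∈ d.autForms1 Γ' :=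
  d.cornerField_isAutForm1 i σ hσ hΓ'

/-- **The corner form is non-zero**: a vanishing gradient on the convex ball makes the coordinate constant there,
contradicting the span clause of `IsAlbaneseLift` (the differences `a_i z − a_i z′` span `ℂ^{T_i}`). -/
theorem cornerField_ne_zero (i : Fin 4) (σ : F →+* ℂ) (hσ : σ ∈ d.T i) : d.cornerField i σ hσ ≠ 0 := by
  intro hzero
  -- the fderiv of the coordinate vanishes on the ball
  have hfd : ∀ z ∈ ball, fderivWithin ℂ (d.coord i σ hσ) ball z = 0 := by
    intro z hz
    rw [fderivWithin_of_isOpen isOpen_ball hz]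
    have hg : grad (d.coord i σ hσ) z = 0 := by
      rw [← d.cornerField_of_mem i σ hσ hz, hzero]
      rfl
    ext w
    rw [fderiv_apply_eq_sum_pd]
    simp only [_root_.zero_apply]
    refine Finset.sum_eq_zero fun k _ => ?_
    have := congrFun hg k
    simp only [grad, Pi.zero_apply] at this
    rw [this, mul_zero]
  -- hence the coordinate is constant on the ball
  have hconst : ∀ z ∈ ball, ∀ z' ∈ ball, d.coord i σ hσ z = d.coord i σ hσ z' := fun z hz z' hz' =>
    convex_ball.is_const_of_fderivWithin_eq_zero (d.differentiableOn_coord i σ hσ) hfd hz hz'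
  -- so every difference of values of the lift has zero `σ`-coordinate
  have hspan := (d.ha i).2.2
  have hle : Submodule.span ℂ {w : ↥(d.T i) → ℂ | ∃ z ∈ ball, ∃ z' ∈ ball, w = d.a i z - d.a i z'} ≤
      LinearMap.ker (LinearMap.proj (⟨σ, hσ⟩ : ↥(d.T i)) : (↥(d.T i) → ℂ) →ₗ[ℂ] ℂ) := by
    rw [Submodule.span_le]
    rintro w ⟨z, hz, z', hz', rfl⟩
    simp only [SetLike.mem_coe, LinearMap.mem_ker, LinearMap.proj_apply, Pi.sub_apply]
    have := hconst z hz z' hz'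
    unfold coord comp at this
    rw [this, sub_self]
  rw [hspan, top_le_iff, LinearMap.ker_eq_top] at hle
  have := LinearMap.congr_fun hle (fun _ => (1 : ℂ))
  simp at this

end TargetData

end Summit.Ventures.HodgeRepro.Tier4
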